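import Summits.Ventures.PercRepro.RankLevelSetContractMono
import Summits.Ventures.PercRepro.RankLevelSetIndepDeficit

/-!
# PercRepro — THE TIGHT LAYER `|E| = p + q`: the middle and top level sets against the independent sets
(night-1, gen 9; paper proofs/NIGHT-1-C025-induction.md §19.1–19.2; part 1 of 2, the counting lemmas)

On the tight layer every member of `U_M(p,q)` is an independent `p`-set whose complement is an independent
`q`-set, and the middle level set `Y_M(p,q)` splits into the independent middle sets (`Σ_{q<u<p} i_u` of them,
`indepSets` of p3's RankLevelSetM) and the dependent ones.  This file records the counting lemmas behind
night-1 g9's decomposition of `σ_M(p,q) − σ_{M／e}(p−1,q)`: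

* `indMid`, `depMid`, `Yset`, `Uset`, `indImg`, `goodImg`, `badImg` — the families;
* `ncard_indMid` (`#indMid = Σ_{q<u<p} i_u`), `sum_add_ncard_depMid_le_midCount` and
  `midCount_le_sum_add_ncard_depMid` (`#Y = Σ i_u + #depMid`, as two inequalities);
* `ncard_depMid_contract_le` — the injection `A′ ↦ insert e A′` of the dependent middle sets of `M ／ {e}` at
  `(p−1, q)` into those of `M` at `(p, q)`;
* `Uset_subset_goodImg` / `goodImg_subset_Uset` — on the tight layer `U(p,q) = {A ∈ I_p : E ∖ A ∈ I}`, hence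
  `topCount_le_ncard_goodImg`, `ncard_goodImg_le_topCount`, and `ncard_goodImg_add_ncard_badImg` (`i_p = #good + #bad`).

Part 2 (RankLevelSetTightContract) turns these into the contraction monotonicity of the slack at an unexposed
element.  Axioms: standard.
-/
open scoped Matroid

namespace PercRepro

open Set Finset

variable {α : Type} (M : Matroid α) [M.Finite]

/-- The independent sets of size strictly between `q` and `p`, as a `Finset` of `Finset`s. -/
noncomputable def indMidFinset (p q : ℕ) : Finset (Finset α) := by
  classical
  exact (Finset.Ioo q p).biUnion (fun u => indepSets M u)

/-- The independent middle sets, as a family of sets. -/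
noncomputable def indMid (p q : ℕ) : Set (Set α) :=
  (fun s : Finset α => (s : Set α)) '' ↑(indMidFinset M p q)

/-- The DEPENDENT middle sets: `A ⊆ E` dependent with `q < r(A) < p`. -/
def depMid (p q : ℕ) : Set (Set α) :=
  {A : Set α | A ⊆ M.E ∧ (q : ℕ∞) < M.eRk A ∧ M.eRk A < (p : ℕ∞) ∧ ¬ M.Indep A}

/-- The middle level set `Y_M(p,q)` (the set-builder of `midCount`). -/
def Yset (p q : ℕ) : Set (Set α) :=
  {A : Set α | A ⊆ M.E ∧ (q : ℕ∞) < M.eRk A ∧ M.eRk A < (p : ℕ∞)}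

/-- The top level set `U_M(p,q)` (the set-builder of `topCount`). -/
def Uset (p q : ℕ) : Set (Set α) :=
  {A : Set α | A ⊆ M.E ∧ M.eRk A = (p : ℕ∞) ∧ M.eRk (M.E \ A) = (q : ℕ∞)}

/-- The independent `p`-sets as a family of sets. -/
noncomputable def indImg (p : ℕ) : Set (Set α) :=
  (fun s : Finset α => (s : Set α)) '' ↑(indepSets M p)

/-- The independent `p`-sets whose complement is independent. -/
noncomputable def goodImg (p : ℕ) : Set (Set α) :=
  indImg M p ∩ {A : Set α | M.Indep (M.E \ A)}

/-- The independent `p`-sets whose complement is dependent. -/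
noncomputable def badImg (p : ℕ) : Set (Set α) :=
  indImg M p \ {A : Set α | M.Indep (M.E \ A)}

omit [M.Finite] in
/-- `midCount` is the size of `Yset`. -/
lemma midCount_eq_ncard_Yset (p q : ℕ) : Matroid.midCount M p q = (Yset M p q).ncard := rfl

omit [M.Finite] in
/-- `topCount` is the size of `Uset`. -/
lemma topCount_eq_ncard_Uset (p q : ℕ) : Matroid.topCount M p q = (Uset M p q).ncard := rfl

/-- `Y` is finite. -/
lemma Yset_finite (p q : ℕ) : (Yset M p q).Finite :=
  (M.set_finite M.E).finite_subsets.subset (fun _ hA => hA.1)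

/-- The dependent middle sets form a finite family. -/
lemma depMid_finite (p q : ℕ) : (depMid M p q).Finite :=
  (M.set_finite M.E).finite_subsets.subset (fun _ hA => hA.1)

/-- The independent `p`-sets form a finite family. -/
lemma indImg_finite (p : ℕ) : (indImg M p).Finite := (Finset.finite_toSet _).image _

/-- `#indMid = Σ_{q<u<p} i_u`. -/
lemma ncard_indMid (p q : ℕ) :
    (indMid M p q).ncard = ∑ u ∈ Finset.Ioo q p, (indepSets M u).card := by
  classical
  unfold indMid
  rw [ncard_image_of_injective _ Finset.coe_injective, ncard_coe_finset]
  unfold indMidFinset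
  rw [Finset.card_biUnion]
  intro u _ v _ huv
  change Disjoint _ _
  rw [Finset.disjoint_left]
  intro s hs hs'
  rw [mem_indepSets M] at hs hs'
  exact huv (hs.2.1.symm.trans hs'.2.1)

/-- Members of `indMid` are independent sets of size (= rank) in `(q, p)`. -/
lemma mem_indMid_iff {p q : ℕ} {A : Set α} :
    A ∈ indMid M p q ↔ A ⊆ M.E ∧ M.Indep A ∧ (q : ℕ∞) < A.encard ∧ A.encard < (p : ℕ∞) := by
  classical
  have hEfin : M.E.Finite := M.set_finite M.E
  constructor
  · rintro ⟨s, hs, rfl⟩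
    rw [Finset.mem_coe] at hs
    unfold indMidFinset at hs
    rw [Finset.mem_biUnion] at hs
    obtain ⟨u, hu, hs⟩ := hs
    rw [mem_indepSets M] at hs
    obtain ⟨hsE, hscard, hsind⟩ := hs
    rw [Finset.mem_Ioo] at hu
    refine ⟨fun x hx => ?_, hsind, ?_, ?_⟩
    · have := hsE hx
      rwa [hEfin.mem_toFinset] at this
    · rw [encard_coe_eq_coe_finsetCard, hscard]; exact_mod_cast hu.1
    · rw [encard_coe_eq_coe_finsetCard, hscard]; exact_mod_cast hu.2
  · rintro ⟨hAE, hAind, hq, hp⟩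
    have hAfin : A.Finite := hEfin.subset hAE
    refine ⟨hAfin.toFinset, ?_, hAfin.coe_toFinset⟩
    rw [Finset.mem_coe]
    unfold indMidFinset
    rw [Finset.mem_biUnion]
    refine ⟨A.ncard, ?_, ?_⟩
    · rw [Finset.mem_Ioo]
      rw [← hAfin.cast_ncard_eq] at hq hp
      exact ⟨by exact_mod_cast hq, by exact_mod_cast hp⟩
    · rw [mem_indepSets M]
      refine ⟨?_, ?_, by rw [hAfin.coe_toFinset]; exact hAind⟩
      · intro x hx
        rw [hAfin.mem_toFinset] at hx
        rw [hEfin.mem_toFinset]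
        exact hAE hx
      · rw [← ncard_eq_toFinset_card A hAfin]

/-- The independent middle sets lie in `Y`. -/
lemma indMid_subset_Yset (p q : ℕ) : indMid M p q ⊆ Yset M p q := by
  intro A hA
  rw [mem_indMid_iff] at hA
  obtain ⟨hAE, hAind, hq, hp⟩ := hA
  refine ⟨hAE, ?_, ?_⟩
  · rw [hAind.eRk_eq_encard]; exact hq
  · rw [hAind.eRk_eq_encard]; exact hp

omit [M.Finite] in
/-- The dependent middle sets lie in `Y`. -/
lemma depMid_subset_Yset (p q : ℕ) : depMid M p q ⊆ Yset M p q :=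
  fun _ hA => ⟨hA.1, hA.2.1, hA.2.2.1⟩

/-- `Y` is covered by the independent and the dependent middle sets. -/
lemma Yset_subset_union (p q : ℕ) : Yset M p q ⊆ indMid M p q ∪ depMid M p q := by
  intro A hA
  obtain ⟨hAE, hq, hp⟩ := hA
  by_cases hind : M.Indep A
  · left
    rw [mem_indMid_iff]
    refine ⟨hAE, hind, ?_, ?_⟩
    · rwa [hind.eRk_eq_encard] at hq
    · rwa [hind.eRk_eq_encard] at hp
  · right
    exact ⟨hAE, hq, hp, hind⟩

/-- The independent and the dependent middle sets are disjoint. -/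
lemma disjoint_indMid_depMid (p q : ℕ) : Disjoint (indMid M p q) (depMid M p q) := by
  rw [Set.disjoint_left]
  intro A hA hA'
  rw [mem_indMid_iff] at hA
  exact hA'.2.2.2 hA.2.1

/-- Lower bound: `#Y ≥ Σ_{q<u<p} i_u + #depMid`. -/
lemma sum_add_ncard_depMid_le_midCount (p q : ℕ) :
    ∑ u ∈ Finset.Ioo q p, (indepSets M u).card + (depMid M p q).ncard ≤ Matroid.midCount M p q := by
  rw [midCount_eq_ncard_Yset, ← ncard_indMid M p q,
    ← ncard_union_eq (disjoint_indMid_depMid M p q) ((Finset.finite_toSet _).image _)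
      (depMid_finite M p q)]
  exact ncard_le_ncard (union_subset (indMid_subset_Yset M p q) (depMid_subset_Yset M p q))
    (Yset_finite M p q)

/-- Upper bound: `#Y ≤ Σ_{q<u<p} i_u + #depMid`. -/
lemma midCount_le_sum_add_ncard_depMid (p q : ℕ) :
    Matroid.midCount M p q ≤ ∑ u ∈ Finset.Ioo q p, (indepSets M u).card + (depMid M p q).ncard := by
  rw [midCount_eq_ncard_Yset, ← ncard_indMid M p q]
  refine le_trans (ncard_le_ncard (Yset_subset_union M p q)
    (((Finset.finite_toSet _).image _).union (depMid_finite M p q))) ?_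
  exact ncard_union_le _ _

omit [M.Finite] in
/-- `M.E \ insert e A = (M ／ {e}).E \ A`. -/
lemma ground_sdiff_insert (e : α) (A : Set α) : M.E \ insert e A = (M ／ {e}).E \ A := by
  rw [Matroid.contract_ground]
  ext x
  simp only [mem_sdiff, mem_insert_iff, mem_singleton_iff, not_or]
  tauto

omit [M.Finite] in
/-- Rank of `insert e A` in `M` is the rank of `A` in `M ／ {e}` plus one (`e` a non-loop, `A ⊆ E ∖ e`). -/
lemma eRk_insert_eq_contract_add_one {e : α} (he : M.IsNonloop e) {A : Set α}
    (hA : A ⊆ (M ／ {e}).E) : M.eRk (insert e A) = (M ／ {e}).eRk A + 1 := by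
  rw [Matroid.contract_ground] at hA
  exact (contract_singleton_eRk_add_one he.indep hA).symm

/-- THE DEPENDENT INJECTION: `A′ ↦ insert e A′` maps the dependent middle sets of `M ／ {e}` at `(p − 1, q)`
into those of `M` at `(p, q)`; hence `#depMid(M／e) ≤ #depMid(M)`. -/
lemma ncard_depMid_contract_le {e : α} (he : M.IsNonloop e) {p q : ℕ} (hp : 1 ≤ p) :
    (depMid (M ／ {e}) (p - 1) q).ncard ≤ (depMid M p q).ncard := by
  have hefin : (M ／ {e}).Finite := inferInstance
  refine ncard_le_ncard_of_injOn (fun A => insert e A) ?_ ?_ (depMid_finite M p q)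
  · rintro A ⟨hAE, hq, hp', hdep⟩
    have heA : e ∉ A := fun h => (hAE h).2 rfl
    have hrk := eRk_insert_eq_contract_add_one M he hAE
    refine ⟨?_, ?_, ?_, ?_⟩
    · exact insert_subset he.mem_ground (hAE.trans (M.contract_ground_subset_ground {e}))
    · rw [hrk]
      exact lt_of_lt_of_le hq (le_self_add)
    · rw [hrk]
      have h1 : (M ／ {e}).eRk A + 1 ≤ ((p - 1 : ℕ) : ℕ∞) :=
        (ENat.add_one_le_iff' (ENat.coe_ne_top _)).2 hp'
      have h2 : ((p - 1 : ℕ) : ℕ∞) < (p : ℕ∞) := by exact_mod_cast (by omega : p - 1 < p)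
      exact lt_of_le_of_lt h1 h2
    · intro hind
      apply hdep
      rw [he.contractElem_indep_iff]
      exact ⟨heA, hind⟩
  · rintro A ⟨hAE, -, -, -⟩ A' ⟨hA'E, -, -, -⟩ hEq
    have heA : e ∉ A := fun h => (hAE h).2 rfl
    have heA' : e ∉ A' := fun h => (hA'E h).2 rfl
    have h1 : insert e A \ {e} = insert e A' \ {e} := by
      simp only at hEq
      rw [hEq]
    rwa [insert_sdiff_self_of_notMem heA, insert_sdiff_self_of_notMem heA'] at h1

/-- Membership in `indImg`: an independent subset of `E` of size `p`. -/
lemma mem_indImg_iff {p : ℕ} {A : Set α} :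
    A ∈ indImg M p ↔ A ⊆ M.E ∧ M.Indep A ∧ A.encard = (p : ℕ∞) := by
  classical
  have hEfin : M.E.Finite := M.set_finite M.E
  constructor
  · rintro ⟨s, hs, rfl⟩
    rw [Finset.mem_coe, mem_indepSets M] at hs
    obtain ⟨hsE, hscard, hsind⟩ := hs
    refine ⟨fun x hx => ?_, hsind, ?_⟩
    · have := hsE hx
      rwa [hEfin.mem_toFinset] at this
    · rw [encard_coe_eq_coe_finsetCard, hscard]
  · rintro ⟨hAE, hAind, hcard⟩
    have hAfin : A.Finite := hEfin.subset hAE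
    refine ⟨hAfin.toFinset, ?_, hAfin.coe_toFinset⟩
    rw [Finset.mem_coe, mem_indepSets M]
    refine ⟨?_, ?_, by rw [hAfin.coe_toFinset]; exact hAind⟩
    · intro x hx
      rw [hAfin.mem_toFinset] at hx
      rw [hEfin.mem_toFinset]
      exact hAE hx
    · rw [← ncard_eq_toFinset_card A hAfin]
      rw [← hAfin.cast_ncard_eq] at hcard
      exact_mod_cast hcard

/-- `#indImg = i_p`. -/
lemma ncard_indImg (p : ℕ) : (indImg M p).ncard = (indepSets M p).card :=
  ncard_image_indepSets M p

/-- `i_p = #good + #bad`. -/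
lemma ncard_goodImg_add_ncard_badImg (p : ℕ) :
    (goodImg M p).ncard + (badImg M p).ncard = (indepSets M p).card := by
  rw [← ncard_indImg M p]
  exact ncard_inter_add_ncard_sdiff_eq_ncard _ _ (indImg_finite M p)

/-- THE TIGHT LAYER: at `|E| = p + q`, every member of `U(p,q)` is an independent `p`-set with independent
complement. -/
lemma Uset_subset_goodImg {p q : ℕ} (hE : M.E.ncard = p + q) : Uset M p q ⊆ goodImg M p := by
  classical
  have hEfin : M.E.Finite := M.set_finite M.E
  rintro A ⟨hA, hpA, hqA⟩
  have hAfin : A.Finite := hEfin.subset hA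
  have hcA : p ≤ A.ncard := by
    have h := hpA ▸ M.eRk_le_encard A
    rw [← hAfin.cast_ncard_eq] at h
    exact_mod_cast h
  have hcEA : q ≤ (M.E \ A).ncard := by
    have h := hqA ▸ M.eRk_le_encard (M.E \ A)
    rw [← (hEfin.subset sdiff_subset).cast_ncard_eq] at h
    exact_mod_cast h
  have hsum := ncard_sdiff_add_ncard_of_subset hA hEfin
  have hAcard : A.ncard = p := by omega
  have hEAcard : (M.E \ A).ncard = q := by omega
  have hind : M.Indep A := by
    rw [Matroid.indep_iff_eRk_eq_encard_of_finite hAfin, hpA, ← hAfin.cast_ncard_eq, hAcard]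
  have hind' : M.Indep (M.E \ A) := by
    rw [Matroid.indep_iff_eRk_eq_encard_of_finite (hEfin.subset sdiff_subset), hqA,
      ← (hEfin.subset sdiff_subset).cast_ncard_eq, hEAcard]
  refine ⟨?_, hind'⟩
  rw [mem_indImg_iff]
  exact ⟨hA, hind, by rw [← hAfin.cast_ncard_eq, hAcard]⟩

/-- `#U ≤ #good` on the tight layer. -/
lemma topCount_le_ncard_goodImg {p q : ℕ} (hE : M.E.ncard = p + q) :
    Matroid.topCount M p q ≤ (goodImg M p).ncard := by
  rw [topCount_eq_ncard_Uset]
  exact ncard_le_ncard (Uset_subset_goodImg M hE) ((indImg_finite M p).inter_of_left _)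

/-- On the tight layer `|E| = p + q`, every independent `p`-set with independent complement is in `U(p,q)`. -/
lemma goodImg_subset_Uset {p q : ℕ} (hE : M.E.ncard = p + q) : goodImg M p ⊆ Uset M p q := by
  have hEfin : M.E.Finite := M.set_finite M.E
  rintro A ⟨hA, hind'⟩
  rw [mem_indImg_iff] at hA
  obtain ⟨hAE, hind, hcard⟩ := hA
  have hAfin : A.Finite := hEfin.subset hAE
  have hAcard : A.ncard = p := by
    rw [← hAfin.cast_ncard_eq] at hcard
    exact_mod_cast hcard
  have hsum := ncard_sdiff_add_ncard_of_subset hAE hEfin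
  have hEAcard : (M.E \ A).ncard = q := by omega
  refine ⟨hAE, ?_, ?_⟩
  · rw [hind.eRk_eq_encard, hcard]
  · rw [hind'.eRk_eq_encard, ← (hEfin.subset sdiff_subset).cast_ncard_eq, hEAcard]

/-- `#good ≤ #U` on the tight layer. -/
lemma ncard_goodImg_le_topCount {p q : ℕ} (hE : M.E.ncard = p + q) :
    (goodImg M p).ncard ≤ Matroid.topCount M p q := by
  rw [topCount_eq_ncard_Uset]
  exact ncard_le_ncard (goodImg_subset_Uset M hE) ((M.set_finite M.E).finite_subsets.subset
    (fun _ hA => hA.1))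

end PercRepro
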